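/-
Copyright (c) 2026 the pub-hodgecm-mathlib formalisation cell (harness21).  Prover seat hodgecm-mathlib-LH4-p02 (g12): STAGE 1a «(D-RAM) FOUR-FRAME» squad of
crux H413 (director s1808; heir LEAD F0P3a-plan (g18) T17-31; dealer LH4-plan (g10) WORD #8 (3) «`dOfPlace = d` is tier-2 prover debt ← #12» ∕ WORD #9 №3 v2), 2026-09-03:
the intrinsic level of record `dOfPlace L v w` of the pieces leaf EQUALS the `d` of every ramified quadratic datum at the place.
-/
import Summits.HodgeConjecture.HodgeConjecture.Theorems.F0P3cDyRamFourFramePieces      -- ★ №3 (dealer LH4-plan (g10), filed LH4-p03 (g11)): `dOfPlace`, `mstarOfRecord`, `mstarFn`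
import Literature.NumberTheory.Automorphic.RamifiedPlaceDifferent                       -- ★ p850872 (F0P3a-p06 (g18)): `valued_galAdicCompletionMap_sub_self_le_of_mem_integer` (residual depth `σ_w ≡ id (mod 𝔭_w^d)`)
import HarnessLib

/-!
# (D-RAM) FOUR-FRAME, tier 2: `dOfPlace L v w = d` and `mstarFn L v w = mstarOfRecord d` for every `IsRamifiedQuadraticDatum σ_w ϖ d t` at a ramified non-split CM place

Cell `pub/hodgecm-mathlib` (D-0151), crux H413 = `stmt-HodgeConjecture-24833`; sibling line `Cruxes/H413/Lines/F0_P3c_DyRamFourFrame.lean` (STAGE 1a).  THEOREMS ONLY (no `def`,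
no `sorry`, no instance ∕ notation).  The pieces leaf №3 (`Theorems/F0P3cDyRamFourFramePieces.lean`) fixes the level of the reference pieces INTRINSICALLY:
`dOfPlace L v w = sInf {n > 0 | ∃ x ∈ 𝒪_w, v_w(x − σ_w x) = exp(−n)}`, `mstarFn L v w = mstarOfRecord (dOfPlace L v w)`; the DATUM-QUANTIFIED tier-1∕tier-2 theorems read their
level as `mstarOfRecord d` of a datum `IsRamifiedQuadraticDatum σ_w ϖ d t`.  THIS file identifies the two (dealer WORD #8 (3): «tier-2 prover debt inside `stub_rankTableWild`, M,
← #12»): the set contains `d` (`x = ϖ`: `v(ϖ − σ_wϖ) = vϖ^d = exp(−d)`, `d ≥ 1`) and `d` is a LOWER bound because `σ_w ≡ id (mod 𝔭_w^d)` on `𝒪_w` — ★ F0P3a-p06 (g18)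
`valued_galAdicCompletionMap_sub_self_le_of_mem_integer` (`|σ_w x − x| ≤ |σ_wϖ − ϖ|` for `x ∈ 𝒪_w`, from the Eisenstein basis `𝒪_w = 𝒪_v ⊕ 𝒪_v ϖ`).  With ★ #12
`eq_of_isRamifiedQuadraticDatum_of_placesOver` (`d` does not depend on the uniformiser) every datum-quantified statement at the place reads the SAME level `mstarFn L v w`.
HONEST LABEL: HC_CM is proved only modulo the 7 printed citations (2 remaining: hLiu418 = stmt-HodgeConjecture-24832, h413 = stmt-HodgeConjecture-24833) until rung 0 closes;
(D-RAM) `stub_DyRamCore` stays PRINT [LanglandsShelstad1989 Thm. p. 484 ∕ Rogawski1990 Prop. 4.9.1 (a)] until the road's END lands; this file moves no registry.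

* **`dOfPlace_eq_of_isRamifiedQuadraticDatum`**, **`mstarFn_eq_of_isRamifiedQuadraticDatum`**.
-/

noncomputable section

namespace Summit.HodgeConjecture.HodgeConjecture.Cruxes.H413.F0P3cDyRamDOfPlaceOfDatum

open scoped Valued WithZero
open NumberField IsDedekindDomain
open Literature.NumberTheory.Automorphic Literature.NumberTheory.Automorphic.UnitaryGroup Literature.NumberTheory.Automorphic.UnitaryThreeFourFrame
  Summit.HodgeConjecture.HodgeConjecture.Cruxes.H413.F0P3cDyRamFourFramePieces

/-- **`dOfPlace L v w = d`** for every `IsRamifiedQuadraticDatum σ_w ϖ d t` at a ramified (`e(w|v) ≠ 1`) non-split (`c • w = w`) CM place: `d` lies in the defining set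
(witness `x = ϖ`), and is a lower bound of it by the residual depth `|σ_w x − x| ≤ |σ_wϖ − ϖ| = exp(−d)` on `𝒪_w` (★ `valued_galAdicCompletionMap_sub_self_le_of_mem_integer`).
[cite: Serre1979, Ch. IV §1 Prop. 4, Ch. IV §2] -/
theorem dOfPlace_eq_of_isRamifiedQuadraticDatum (L : Type) [Field L] [NumberField L] [IsCMField L] {v : HeightOneSpectrum (𝓞 ↥(maximalRealSubfield L))}
    (w : PlacesOver L v) (hw : IsCMField.complexConj L • w.1 = w.1) (he : v.asIdeal.ramificationIdx' w.1.asIdeal ≠ 1) {ϖ : w.1.adicCompletion L} {d t : ℕ}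
    (hD : IsRamifiedQuadraticDatum (galAdicCompletionMap (L := L) (IsCMField.complexConj L) hw) ϖ d t) : dOfPlace L v w = d := by
  obtain ⟨-, -, hϖ, -, hd, h1d, -⟩ := hD
  rw [dOfPlace, dif_pos hw]
  have hϖ1 : Valued.v ϖ ≤ 1 := by rw [hϖ, ← WithZero.exp_zero, WithZero.exp_le_exp]; omega
  have hexp : Valued.v (ϖ - galAdicCompletionMap (L := L) (IsCMField.complexConj L) hw ϖ) = WithZero.exp (-(d : ℤ)) := by
    rw [hd, hϖ, ← WithZero.exp_nsmul, nsmul_eq_mul, mul_neg, mul_one]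
  have hmem : d ∈ {n : ℕ | 0 < n ∧ ∃ x : w.1.adicCompletion L, Valued.v x ≤ 1 ∧
      Valued.v (x - galAdicCompletionMap (L := L) (IsCMField.complexConj L) hw x) = WithZero.exp (-(n : ℤ))} := ⟨h1d, ϖ, hϖ1, hexp⟩
  refine le_antisymm (Nat.sInf_le hmem) (le_csInf ⟨d, hmem⟩ ?_)
  rintro n ⟨-, x, hx1, hxn⟩
  have hle := valued_galAdicCompletionMap_sub_self_le_of_mem_integer L v w hw he hϖ hx1
  rw [Valuation.map_sub_swap, hxn, Valuation.map_sub_swap, hexp, WithZero.exp_le_exp] at hle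
  omega

/-- **`mstarFn L v w = mstarOfRecord d`** for every datum at the place: the pieces' intrinsic level IS the level of record `m* = d % 2 + 2d − 1` of any
`IsRamifiedQuadraticDatum σ_w ϖ d t` (so the datum-quantified stubs and the intrinsic pieces `f_T`, `f_reg`, `PiecePropsWild mstarFn gselStar` speak of one level).
[cite: Serre1979, Ch. IV §1 Prop. 4] -/
theorem mstarFn_eq_of_isRamifiedQuadraticDatum (L : Type) [Field L] [NumberField L] [IsCMField L] {v : HeightOneSpectrum (𝓞 ↥(maximalRealSubfield L))}
    (w : PlacesOver L v) (hw : IsCMField.complexConj L • w.1 = w.1) (he : v.asIdeal.ramificationIdx' w.1.asIdeal ≠ 1) {ϖ : w.1.adicCompletion L} {d t : ℕ}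
    (hD : IsRamifiedQuadraticDatum (galAdicCompletionMap (L := L) (IsCMField.complexConj L) hw) ϖ d t) : mstarFn L v w = mstarOfRecord d := by
  rw [mstarFn, dOfPlace_eq_of_isRamifiedQuadraticDatum L w hw he hD]

end Summit.HodgeConjecture.HodgeConjecture.Cruxes.H413.F0P3cDyRamDOfPlaceOfDatum

end
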